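import Summits.CriticalPhenomena.PercolationContinuityZ3.Theorems.Transplant.FKConnectivityAllQK5DisjBridge
import Summits.CriticalPhenomena.PercolationContinuityZ3.Theorems.Transplant.FKConnectivityAllQK5
import Summits.CriticalPhenomena.PercolationContinuityZ3.Theorems.Transplant.FKRayleighK4
import HarnessLib

/-!
# `K₅` is Potts–Rayleigh (`0 < q ≤ 1`), disjoint pairs — file 6: from five certified slices to negative correlation on `Fin 5`

Helper file (`--supports stmt-CriticalPhenomena-4575`), FK sub-lane `prim-bschramm-fk-3` (gen 11) of the post-continuity programme;
builds on p205010 (kernel theorem, internal audit signed; external expert review pending).  No named facts, no sorries; standard axioms.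

THE THEOREM OF THIS CHAIN (`…K5Disj`): **`K₅` is Potts–Rayleigh for every `0 < q ≤ 1`** — the random-cluster measure `φ_{w,q}` on every
weighted graph with at most five vertices is edge-negatively associated, `φ(J_e ∩ J_f) ≤ φ(J_e)φ(J_f)` for ALL pairs `e ≠ f` (adjacent pairs:
gen 10, `…K5`; this chain: the disjoint pairs, one `S₅`-orbit, `(e, f) = (01, 23)`).  Wagner 2008, Ex. 5.2 records Sokal's computation for
`K₄`; for `K₅` the Rayleigh difference `Z¹⁰Z⁰¹ − Z⁰⁰Z¹¹` of `(01, 23)` has negative coefficients that no binomial (AM–GM) square repairs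
(gen 10, LP scoping), so the certificate is a SUM OF GRAM SQUARES: with `y` the odds parameters of the eight pairs `E₈' = K₅ − {01, 23}`,
the reduced difference `D̂ = (Z¹⁰Z⁰¹ − Z⁰⁰Z¹¹)/(q²(1−q))` (degree `4` in `q`) is written in the scaled Bernstein basis
`Σ_{j ≤ 4} B̃_j(y) q^j (1−q)^{4−j}`, and each slice `B̃_j` is certified `≥ 0` on the orthant as
`B̃_j = Σ_T y^T · m_Tᵀ H_{T,j} m_T + (nonnegative coefficients)`, `|T| ≤ 2`, `m_T` the multi-affine monomials off `T` inside the
Newton polytope, `H_{T,j} = U K Uᵀ` integer positive semidefinite (witness `s²K = LLᵀ + E`, `E` diagonally dominant).  The certificates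
were found by semidefinite programming, facial reduction and integer rounding OUTSIDE Lean (bschramm/FK-BARRIER.md §15) and are CHECKED
HERE BY THE KERNEL (`decide +kernel`), fiber by fiber (`3^8 = 6561` fibers per slice).
[cite: Wagner2006, Ex. 5.2, Conj. 5.3, Thm. 5.8 (p. 13)] [cite: Grimmett2006, §3.9 eq. (3.94), Conj. (3.96) (pp. 63–66); §1.4 eq. (1.20) (p. 15)]

THIS FILE (conditional on `∀ j ≤ 4, K5D.SliceCertified j`, which the data files `…K5DisjCert*` discharge; assembled in `…K5Disj`):
**`pairSum_nonneg`** — the pair sum `Σ vW vW Σ_e pairCoef q^e` equals `q⁴·Σ_t a_t q^t` whose scaled Bernstein coefficients are the slice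
sums of `…K5DisjFibers`, hence `≥ 0` on `[0,1]` (gen 9's Bernstein criterion); **`bracket_nonpos`**; the master identity ⇒
**`nc_norm_d5`** (`φ(J_{01} ∩ J_{23}) ≤ φ(J_{01})φ(J_{23})` for loop-free weights on `Fin 5`); relabelling (`nc_of_relabel`) and gen 10's
adjacent theorem `edgeNegCorrAdjOn_fin_five` ⇒ **`edgeNegCorrOn_fin_five_of_cert`**.
-/

namespace Summit.CriticalPhenomena.PercolationContinuityZ3.Theorems

namespace FK

namespace K5D

open Finset

open MeasureTheory Literature.Probability.LatticeModels Literature.Probability.Percolation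
open Literature.Probability.Percolation.DecisionTree (ind ind_of_mem ind_of_not_mem)
open scoped Classical

/-- `bern k` is the scaled Bernstein coefficient `Σ_{e≤k} c_{e+4} C(4−e,k−e)` (`k ≤ 4`). [folklore] -/
theorem bern_eq_sum {k : ℕ} (hk : k ≤ 4) (b : List ℤ) :
    ((bern k b : ℤ) : ℝ) = ∑ e ∈ Finset.range (k + 1), ((zAt b (e + 4) : ℤ) : ℝ) * ((4 - e).choose (k - e) : ℝ) := by
  interval_cases k <;> simp [bern, Finset.sum_range_succ, Nat.choose] <;> ring

/-- **The pair sum is nonnegative**: with all five slices certified, for every `u ∈ [0,1]⁸` and `q ∈ [0,1]`,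
`0 ≤ Σ_{m₂} Σ_{m₁} vW(m₁) vW(m₂) · Σ_e pairCoef(m₁,m₂,e) q^e`. -/
theorem pairSum_nonneg (hcert : ∀ j ≤ 4, SliceCertified j) (u : Fin 8 → ℝ) (h0 : ∀ i, 0 ≤ u i) (h1 : ∀ i, u i ≤ 1)
    {q : ℝ} (hq0 : 0 ≤ q) (hq1 : q ≤ 1) :
    0 ≤ ∑ m₂ ∈ Finset.range 256, ∑ m₁ ∈ Finset.range 256, vW u m₁ * vW u m₂ *
        ∑ e ∈ Finset.range 13, ((pairCoef m₁ m₂ e : ℤ) : ℝ) * q ^ e := by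
  obtain ⟨den0, cert0, _, _, hfib0⟩ := hcert 0 (by norm_num)
  rw [sum_pairs_eq_sum_fibers]
  -- per fiber: the inner sum is `q⁴ · Σ_{t<5} c_{t+4} q^t`
  have hinner : ∀ J ∈ Finset.range 256, ∀ I ∈ Finset.range 256, I &&& J = I →
      ((submasks (J - I)).map fun S => ∑ e ∈ Finset.range 13, ((pairCoef (I + S) (J - S) e : ℤ) : ℝ) * q ^ e).sum =
        q ^ 4 * ∑ t ∈ Finset.range 5, ((zAt (fiberBins I J) (t + 4) : ℤ) : ℝ) * q ^ t := by
    intro J hJ I hI hIJ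
    have hJ' := Finset.mem_range.1 hJ; have hI' := Finset.mem_range.1 hI
    have hswap : ∀ (l : List ℕ) (f : ℕ → ℕ → ℝ),
        (l.map fun a => ∑ e ∈ Finset.range 13, f a e).sum = ∑ e ∈ Finset.range 13, (l.map fun a => f a e).sum := by
      intro l f
      induction l with
      | nil => simp
      | cons a l ih => rw [List.map_cons, List.sum_cons, ih, ← Finset.sum_add_distrib]; simp
    rw [hswap]
    have hcoef : ∀ e ∈ Finset.range 13, ((submasks (J - I)).map fun S => ((pairCoef (I + S) (J - S) e : ℤ) : ℝ) * q ^ e).sum =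
        ((zAt (fiberBins I J) e : ℤ) : ℝ) * q ^ e := by
      intro e _
      rw [List.sum_map_mul_right, zAt_fiberBins hI' hJ' hIJ, Int.cast_list_sum, List.map_map]
      rfl
    rw [Finset.sum_congr rfl hcoef]
    have hclean := (hfib0 J hJ' I hI' hIJ).1
    unfold binsClean at hclean
    simp only [Bool.and_eq_true, beq_iff_eq] at hclean
    obtain ⟨⟨⟨⟨⟨⟨⟨c0, c1⟩, c2⟩, c3⟩, c9⟩, c10⟩, c11⟩, c12⟩ := hclean
    rw [show (13 : ℕ) = 4 + 5 + 4 from rfl, Finset.sum_range_add, Finset.sum_range_add]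
    have hlo : ∑ e ∈ Finset.range 4, ((zAt (fiberBins I J) e : ℤ) : ℝ) * q ^ e = 0 := by
      simp [Finset.sum_range_succ, c0, c1, c2, c3]
    have hhi : ∑ e ∈ Finset.range 4, ((zAt (fiberBins I J) (4 + 5 + e) : ℤ) : ℝ) * q ^ (4 + 5 + e) = 0 := by
      simp [Finset.sum_range_succ, c9, c10, c11, c12]
    rw [hlo, hhi, zero_add, add_zero, Finset.mul_sum]
    refine Finset.sum_congr rfl fun t _ => ?_
    rw [show 4 + t = t + 4 from Nat.add_comm 4 t, pow_add]; ring
  have hrw : ∀ J ∈ Finset.range 256, ∀ I ∈ Finset.range 256,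
      (if I &&& J = I then cW u I J * ((submasks (J - I)).map fun S =>
        ∑ e ∈ Finset.range 13, ((pairCoef (I + S) (J - S) e : ℤ) : ℝ) * q ^ e).sum else 0) =
      q ^ 4 * ∑ t ∈ Finset.range 5, (if I &&& J = I then cW u I J * ((zAt (fiberBins I J) (t + 4) : ℤ) : ℝ) else 0) * q ^ t := by
    intro J hJ I hI
    by_cases hIJ : I &&& J = I
    · simp only [if_pos hIJ]
      rw [hinner J hJ I hI hIJ]
      simp only [Finset.mul_sum]
      exact Finset.sum_congr rfl fun t _ => by ring
    · simp [hIJ]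
  rw [Finset.sum_congr rfl fun J hJ => Finset.sum_congr rfl fun I hI => hrw J hJ I hI]
  simp only [← Finset.mul_sum]
  refine mul_nonneg (pow_nonneg hq0 4) ?_
  rw [Finset.sum_comm]
  simp only [Finset.sum_comm (s := Finset.range 256) (t := Finset.range 5)]
  -- now: Σ_t (Σ_I Σ_J a(I,J,t)) q^t with Bernstein coefficients = slice sums
  have hform : ∑ t ∈ Finset.range 5, ∑ I ∈ Finset.range 256, ∑ J ∈ Finset.range 256,
      (if I &&& J = I then cW u I J * ((zAt (fiberBins I J) (t + 4) : ℤ) : ℝ) else 0) * q ^ t =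
      ∑ t ∈ Finset.range (4 + 1), (fun t => ∑ I ∈ Finset.range 256, ∑ J ∈ Finset.range 256,
        (if I &&& J = I then cW u I J * ((zAt (fiberBins I J) (t + 4) : ℤ) : ℝ) else 0)) t * q ^ t := by
    refine Finset.sum_congr rfl fun t _ => ?_
    rw [Finset.sum_mul]
    exact Finset.sum_congr rfl fun I _ => by rw [Finset.sum_mul]
  rw [hform]
  refine sum_mul_pow_nonneg_of_bernstein (d := 4) (fun k hk => ?_) hq0 hq1
  obtain ⟨den, cert, hden, hblocks, hfib⟩ := hcert k hk
  have hs := slice_nonneg u h0 h1 hden hblocks (fun J hJ I hI hIJ => (hfib J hJ I hI hIJ).2) (j := k)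
  -- identify with the slice sum
  have hident : ∑ e ∈ Finset.range (k + 1), (∑ I ∈ Finset.range 256, ∑ J ∈ Finset.range 256,
      (if I &&& J = I then cW u I J * ((zAt (fiberBins I J) (e + 4) : ℤ) : ℝ) else 0)) * ((4 - e).choose (k - e) : ℝ) =
      ∑ I ∈ Finset.range 256, ∑ J ∈ Finset.range 256, if I &&& J = I then cW u I J * ((bern k (fiberBins I J) : ℤ) : ℝ) else 0 := by
    simp only [Finset.sum_mul]
    rw [Finset.sum_comm]
    refine Finset.sum_congr rfl fun I _ => ?_
    rw [Finset.sum_comm]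
    refine Finset.sum_congr rfl fun J _ => ?_
    by_cases hIJ : I &&& J = I
    · simp only [if_pos hIJ]
      rw [bern_eq_sum hk, Finset.mul_sum]
      exact Finset.sum_congr rfl fun e _ => by ring
    · simp [hIJ]
  rw [hident, Finset.sum_comm]
  exact hs

variable {U : Sym2 (Fin 5) → unitInterval}

/-- **The bracket is nonpositive** for weight vectors supported in the listed pairs (all slices certified). -/
theorem bracket_nonpos (hcert : ∀ j ≤ 4, SliceCertified j) (U₁ : Sym2 (Fin 5) → unitInterval)
    (hU : ∀ e, e ∉ Set.range listing.edge → (U e : ℝ) = 0) (hUf : U s(2, 3) = 0) (hU₁ : U₁ s(2, 3) = 1)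
    (hU₁' : ∀ e, e ≠ s(2, 3) → U₁ e = U e) {q : ℝ} (hq0 : 0 < q) (hq1 : q ≤ 1) :
    (∑ ω : BondConfig (Fin 5), rcWeightW U₁ q ∅ ω * ind (openConn (0 : Fin 5) 1)ᶜ ω) * rcPartitionFunctionW U q ∅ -
      (∑ ω : BondConfig (Fin 5), rcWeightW U q ∅ ω * ind (openConn (0 : Fin 5) 1)ᶜ ω) * rcPartitionFunctionW U₁ q ∅ ≤ 0 := by
  have h := bracket_eq (U := U) U₁ hU hUf hU₁ hU₁' hq0.ne'
  have hnn := pairSum_nonneg hcert (uOf U) (uOf_nonneg U) (uOf_le_one U) hq0.le hq1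
  nlinarith

open MeasureTheory Literature.Probability.LatticeModels Literature.Probability.Percolation
open Literature.Probability.Percolation.DecisionTree (ind ind_of_mem ind_of_not_mem)
open scoped Classical

/-- From the master identity and a nonpositive bracket to negative correlation (`Fin 5`, `e = 01`). -/
theorem nc_of_bracket5 (w : Sym2 (Fin 5) → unitInterval) {q : ℝ} (hq0 : 0 < q) (hq1 : q ≤ 1) (f : Sym2 (Fin 5))
    (hfe : f ≠ s(0, 1))
    (hbr : (∑ ω : BondConfig (Fin 5), rcWeightW (Function.update (Function.update w s(0, 1) 0) f 1) q ∅ ω *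
              ind (openConn (0 : Fin 5) 1 : Set (BondConfig (Fin 5)))ᶜ ω) *
            rcPartitionFunctionW (Function.update (Function.update w s(0, 1) 0) f 0) q ∅ -
          (∑ ω : BondConfig (Fin 5), rcWeightW (Function.update (Function.update w s(0, 1) 0) f 0) q ∅ ω *
              ind (openConn (0 : Fin 5) 1 : Set (BondConfig (Fin 5)))ᶜ ω) *
            rcPartitionFunctionW (Function.update (Function.update w s(0, 1) 0) f 1) q ∅ ≤ 0) :
    (rcMeasureW w q ∅).real ({ω | s((0 : Fin 5), 1) ∈ ω} ∩ {ω | f ∈ ω}) ≤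
      (rcMeasureW w q ∅).real {ω | s((0 : Fin 5), 1) ∈ ω} * (rcMeasureW w q ∅).real {ω | f ∈ ω} := by
  have hZ := rcPartitionFunctionW_pos w hq0 (∅ : Set (Fin 5))
  rw [rcMeasureW_real_eq_sum_div w hq0 ∅, rcMeasureW_real_eq_sum_div w hq0 ∅, rcMeasureW_real_eq_sum_div w hq0 ∅,
    div_mul_div_comm, div_le_div_iff₀ hZ (mul_pos hZ hZ)]
  have hm : (∑ ω : BondConfig (Fin 5), rcWeightW w q ∅ ω * ind ({ω | s((0 : Fin 5), 1) ∈ ω} ∩ {ω | f ∈ ω}) ω) *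
        rcPartitionFunctionW w q ∅ -
      (∑ ω : BondConfig (Fin 5), rcWeightW w q ∅ ω * ind {ω | s((0 : Fin 5), 1) ∈ ω} ω) *
        (∑ ω : BondConfig (Fin 5), rcWeightW w q ∅ ω * ind {ω | f ∈ ω} ω) =
      (w s((0 : Fin 5), 1) : ℝ) * (1 - (w s((0 : Fin 5), 1) : ℝ)) * ((w f : ℝ) * (1 - (w f : ℝ))) * (q⁻¹ - 1) *
        ((∑ ω : BondConfig (Fin 5), rcWeightW (Function.update (Function.update w s(0, 1) 0) f 1) q ∅ ω *
              ind (openConn (0 : Fin 5) 1 : Set (BondConfig (Fin 5)))ᶜ ω) *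
            rcPartitionFunctionW (Function.update (Function.update w s(0, 1) 0) f 0) q ∅ -
          (∑ ω : BondConfig (Fin 5), rcWeightW (Function.update (Function.update w s(0, 1) 0) f 0) q ∅ ω *
              ind (openConn (0 : Fin 5) 1 : Set (BondConfig (Fin 5)))ᶜ ω) *
            rcPartitionFunctionW (Function.update (Function.update w s(0, 1) 0) f 1) q ∅) :=
    by convert negCorr_defect_eq w hq0.ne' (0 : Fin 5) 1 hfe
  have hc0 : 0 ≤ (w s((0 : Fin 5), 1) : ℝ) := (w _).2.1
  have hc1 : (w s((0 : Fin 5), 1) : ℝ) ≤ 1 := (w _).2.2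
  have hd0 : 0 ≤ (w f : ℝ) := (w _).2.1
  have hd1 : (w f : ℝ) ≤ 1 := (w _).2.2
  have hq' : 0 ≤ q⁻¹ - 1 := by rw [sub_nonneg]; exact one_le_inv_iff₀.2 ⟨hq0, hq1⟩
  have hpre : 0 ≤ (w s((0 : Fin 5), 1) : ℝ) * (1 - (w s((0 : Fin 5), 1) : ℝ)) * ((w f : ℝ) * (1 - (w f : ℝ))) * (q⁻¹ - 1) :=
    mul_nonneg (mul_nonneg (mul_nonneg hc0 (by linarith)) (mul_nonneg hd0 (by linarith))) hq'
  have h1 := mul_nonpos_iff.2 (Or.inl ⟨hpre, hbr⟩)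
  have h2 : (∑ ω : BondConfig (Fin 5), rcWeightW w q ∅ ω * ind ({ω | s((0 : Fin 5), 1) ∈ ω} ∩ {ω | f ∈ ω}) ω) *
      rcPartitionFunctionW w q ∅ ≤
      (∑ ω : BondConfig (Fin 5), rcWeightW w q ∅ ω * ind {ω | s((0 : Fin 5), 1) ∈ ω} ω) *
        (∑ ω : BondConfig (Fin 5), rcWeightW w q ∅ ω * ind {ω | f ∈ ω} ω) := by linarith [hm, h1]
  calc (∑ ω : BondConfig (Fin 5), rcWeightW w q ∅ ω * ind ({ω | s((0 : Fin 5), 1) ∈ ω} ∩ {ω | f ∈ ω}) ω) *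
        (rcPartitionFunctionW w q ∅ * rcPartitionFunctionW w q ∅)
      = (∑ ω : BondConfig (Fin 5), rcWeightW w q ∅ ω * ind ({ω | s((0 : Fin 5), 1) ∈ ω} ∩ {ω | f ∈ ω}) ω) *
        rcPartitionFunctionW w q ∅ * rcPartitionFunctionW w q ∅ := by ring
    _ ≤ (∑ ω : BondConfig (Fin 5), rcWeightW w q ∅ ω * ind {ω | s((0 : Fin 5), 1) ∈ ω} ω) *
        (∑ ω : BondConfig (Fin 5), rcWeightW w q ∅ ω * ind {ω | f ∈ ω} ω) * rcPartitionFunctionW w q ∅ :=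
        mul_le_mul_of_nonneg_right h2 hZ.le

/-- **`K₅` is Potts–Rayleigh, disjoint pairs**: for a loop-free weight vector on `Fin 5` and `0 < q ≤ 1`,
`φ(J_{01} ∩ J_{23}) ≤ φ(J_{01})·φ(J_{23})` — given the five slice certificates. -/
theorem nc_norm_d5 (hcert : ∀ j ≤ 4, SliceCertified j) (w : Sym2 (Fin 5) → unitInterval)
    (hw : ∀ x : Fin 5, (w s(x, x) : ℝ) = 0) {q : ℝ} (hq0 : 0 < q) (hq1 : q ≤ 1) :
    (rcMeasureW w q ∅).real ({ω | s((0 : Fin 5), 1) ∈ ω} ∩ {ω | s((2 : Fin 5), 3) ∈ ω}) ≤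
      (rcMeasureW w q ∅).real {ω | s((0 : Fin 5), 1) ∈ ω} * (rcMeasureW w q ∅).real {ω | s((2 : Fin 5), 3) ∈ ω} := by
  have hfe : s((2 : Fin 5), 3) ≠ s(0, 1) := by decide
  refine nc_of_bracket5 w hq0 hq1 _ hfe ?_
  set U : Sym2 (Fin 5) → unitInterval := Function.update (Function.update w s(0, 1) 0) s(2, 3) 0 with hUdef
  set U₁ : Sym2 (Fin 5) → unitInterval := Function.update (Function.update w s(0, 1) 0) s(2, 3) 1 with hU₁def
  have hUf : U s(2, 3) = 0 := by rw [hUdef, Function.update_self]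
  have hU₁ : U₁ s(2, 3) = 1 := by rw [hU₁def, Function.update_self]
  have hU₁' : ∀ e, e ≠ s(2, 3) → U₁ e = U e := by
    intro e he; rw [hUdef, hU₁def, Function.update_of_ne he, Function.update_of_ne he]
  have hU : ∀ e, e ∉ Set.range listing.edge → (U e : ℝ) = 0 := by
    intro e he
    by_cases h23 : e = s(2, 3)
    · rw [h23, hUf]; rfl
    by_cases h01 : e = s(0, 1)
    · rw [h01, hUdef, Function.update_of_ne (by decide : s((0 : Fin 5), 1) ≠ s(2, 3)), Function.update_self]; rfl
    by_cases hd : e.IsDiag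
    · rw [hUdef, Function.update_of_ne h23, Function.update_of_ne h01]
      induction e using Sym2.ind with
      | h a b =>
        have hab : a = b := Sym2.mk_isDiag_iff.1 hd
        subst hab
        exact hw a
    · exact absurd (exists_edge_eq e hd h01 h23) (fun ⟨i, hi⟩ => he ⟨i, hi⟩)
  exact bracket_nonpos hcert U₁ hU hUf hU₁ hU₁' hq0 hq1

/-- The remaining element of `Fin 5`. -/
theorem fin5_exists_fifth (x y u v : Fin 5) : ∃ t : Fin 5, t ≠ x ∧ t ≠ y ∧ t ≠ u ∧ t ≠ v := by
  revert x y u v; decide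

/-- A bijection of `Fin 5` with prescribed distinct values on `0, 1, 2, 3`. -/
theorem fin5_exists_equiv (x y u v : Fin 5) (hxy : x ≠ y) (hxu : x ≠ u) (hxv : x ≠ v) (hyu : y ≠ u) (hyv : y ≠ v)
    (huv : u ≠ v) : ∃ σ : Fin 5 ≃ Fin 5, σ 0 = x ∧ σ 1 = y ∧ σ 2 = u ∧ σ 3 = v := by
  obtain ⟨t, htx, hty, htu, htv⟩ := fin5_exists_fifth x y u v
  let g : Fin 5 → Fin 5 := fun i => if i = 0 then x else if i = 1 then y else if i = 2 then u else if i = 3 then v else t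
  have hg : Function.Injective g := by
    intro i j hij
    rcases (show ∀ i : Fin 5, i = 0 ∨ i = 1 ∨ i = 2 ∨ i = 3 ∨ i = 4 by decide) i with rfl | rfl | rfl | rfl | rfl <;>
      rcases (show ∀ j : Fin 5, j = 0 ∨ j = 1 ∨ j = 2 ∨ j = 3 ∨ j = 4 by decide) j with rfl | rfl | rfl | rfl | rfl <;>
      simp +decide only [g, if_true, if_false] at hij <;> first | rfl | (exfalso; simp_all)
  refine ⟨Equiv.ofBijective g (Finite.injective_iff_bijective.1 hg), ?_, ?_, ?_, ?_⟩ <;>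
    simp +decide [Equiv.ofBijective_apply, g]

/-- Negative edge correlation on `Fin 5`, loop-free case (given the certificates). -/
theorem nc_loopfree5 (hcert : ∀ j ≤ 4, SliceCertified j) (w : Sym2 (Fin 5) → unitInterval)
    (hw : ∀ g : Sym2 (Fin 5), g.IsDiag → (w g : ℝ) = 0) {q : ℝ} (hq0 : 0 < q) (hq1 : q ≤ 1) (x y u v : Fin 5)
    (hxy : x ≠ y) (huv : u ≠ v) (hne : s(u, v) ≠ s(x, y)) :
    (rcMeasureW w q ∅).real ({ω | s(x, y) ∈ ω} ∩ {ω | s(u, v) ∈ ω}) ≤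
      (rcMeasureW w q ∅).real {ω | s(x, y) ∈ ω} * (rcMeasureW w q ∅).real {ω | s(u, v) ∈ ω} := by
  -- adjacent pairs: gen-10 kernel theorem
  by_cases hadj : ∃ z : Fin 5, z ∈ s(x, y) ∧ z ∈ s(u, v)
  · exact edgeNegCorrAdjOn_fin_five hq0 hq1 w s(x, y) s(u, v) (fun h => hxy (Sym2.mk_isDiag_iff.1 h))
      (fun h => huv (Sym2.mk_isDiag_iff.1 h)) hne hadj
  -- disjoint pairs: relabel to `(01, 23)`
  have hxu : x ≠ u := fun h => hadj ⟨x, Sym2.mem_mk_left _ _, h ▸ Sym2.mem_mk_left _ _⟩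
  have hxv : x ≠ v := fun h => hadj ⟨x, Sym2.mem_mk_left _ _, h ▸ Sym2.mem_mk_right _ _⟩
  have hyu : y ≠ u := fun h => hadj ⟨y, Sym2.mem_mk_right _ _, h ▸ Sym2.mem_mk_left _ _⟩
  have hyv : y ≠ v := fun h => hadj ⟨y, Sym2.mem_mk_right _ _, h ▸ Sym2.mem_mk_right _ _⟩
  obtain ⟨σ, h0, h1, h2, h3⟩ := fin5_exists_equiv x y u v hxy hxu hxv hyu hyv huv
  have hwσ : ∀ z : Fin 5, ((w ∘ sym2Equiv σ) s(z, z) : ℝ) = 0 :=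
    fun z => hw _ (by rw [sym2Equiv_mk]; exact Sym2.mk_isDiag_iff.2 rfl)
  refine nc_of_relabel σ w hq0 (e' := s(0, 1)) (f' := s(2, 3)) (by rw [sym2Equiv_mk, h0, h1])
    (by rw [sym2Equiv_mk, h2, h3]) ?_
  exact nc_norm_d5 hcert (w ∘ sym2Equiv σ) hwσ hq0 hq1

/-- **`K₅` is Potts–Rayleigh for every `0 < q ≤ 1`** (given the certificates): `EdgeNegCorrOn (Fin 5) q`. -/
theorem edgeNegCorrOn_fin_five_of_cert (hcert : ∀ j ≤ 4, SliceCertified j) {q : ℝ} (hq0 : 0 < q) (hq1 : q ≤ 1) :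
    EdgeNegCorrOn (Fin 5) q := by
  intro w e f he hfe
  by_cases hf : f.IsDiag
  · induction f using Sym2.ind with
    | h x' y' =>
      have hxy : x' = y' := Sym2.mk_isDiag_iff.1 hf
      subst hxy
      have hne : e ≠ s(x', x') := fun h => he (h ▸ Sym2.mk_isDiag_iff.2 rfl)
      exact (rcMeasureW_real_inter_loop w hq0 x' hne).le
  · rw [rcMeasureW_real_eraseLoops w hq0 _ (openPair_inter_loop_insensitive he hf),
      rcMeasureW_real_eraseLoops w hq0 _ (openPair_loop_insensitive he),
      rcMeasureW_real_eraseLoops w hq0 _ (openPair_loop_insensitive hf)]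
    induction e using Sym2.ind with
    | h x y =>
      induction f using Sym2.ind with
      | h u v =>
        refine nc_loopfree5 hcert _ (fun g hg => ?_) hq0 hq1 x y u v (fun h => he (Sym2.mk_isDiag_iff.2 h))
          (fun h => hf (Sym2.mk_isDiag_iff.2 h)) hfe
        simp [hg]

end K5D

end FK

end Summit.CriticalPhenomena.PercolationContinuityZ3.Theorems
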